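import Literature.MathematicalPhysics.StatisticalMechanics.ComplexSpinCorrelationBound
import HarnessLib

/-!
# Thermodynamic limits along subsequences: Salmhofer–Seiler's Theorem 3.18 (2)
# (CMP 139 (1991), Thm. 3.18 (2) (3.60) with (3.66)–(3.68))

Seventeenth file of the Salmhofer–Seiler series; theorems only (no definition, no named fact).
`ComplexSpinCorrelationBound` proves Thm. 3.18 (1), `0 ≤ ⟨σ^L⟩_Λ ≤ 1` for every monomial on every
even torus.  The printed part (2) — existence of the thermodynamic limit of all correlation
functions — is proved in print by Banach–Alaoglu: the functionals `f_Λ : a ↦ ∑_L a_L⟨σ^L⟩_Λ` on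
`X = L¹(ℒ)` have norm `≤ 1` by part (1), so "the sequence `(f_Λ)` has accumulation points … there are
subsequences `(Λ_k)` so that `(f_{Λ_k}(a))` converges for all `a ∈ X`".  What is actually
established is the existence of limits ALONG SUBSEQUENCES, and that is what is proved here, in the
equivalent "separable" form: by part (1) the vectors `(⟨σ^L⟩_{Λ_n})_{L ∈ ℒ}` lie in the cube
`[0,1]^{ℒ}`, `ℒ = {L : ℤ^ν →₀ ℕ}` countable, which is compact (Tychonoff) and first countable,
hence sequentially compact.

* **`exists_subseq_tendsto_expect`** — for every sequence of even tori `Λ_n = (ℤ/L_n)^ν` there are a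
  subsequence `n_j` and limits `⟨σ^L⟩ ∈ [0,1]` with `⟨σ^L⟩_{Λ_{n_j}} → ⟨σ^L⟩` for all `L ∈ ℒ`
  simultaneously (a monomial on `ℤ^ν` is read on `Λ_n` through the projection `Torus.proj`);
  `uN_exists_subseq_tendsto_expect` — the `U(N)` model, `N ≤ 4`.

Not formalised: uniqueness of the limit (for `m ≠ 0` this is the cluster expansion, Thms. 3.8/3.11,
Remark 3.19), part (3) (the Fourier transforms as distributions) and Thm. 3.23.  Honest framing:
`β = 0` complex spin systems on even tori; nothing about `β > 0`, the continuum, `SU(N)` or the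
summit's `QCD` conjunct.

## References

* M. Salmhofer, E. Seiler, Commun. Math. Phys. 139 (1991) 395–432: Thm. 3.18 (2) (3.60), proof
  (3.66)–(3.68) (p. 412). [SalmhoferSeiler1991]

## Mathlib

`isCompact_univ_pi` (Tychonoff for `[0,1]^{ℒ}`), `IsCompact.isSeqCompact` (first-countable spaces),
`tendsto_pi_nhds`; `Countable (ℤ^ν →₀ ℕ)` and the first countability of `ℒ → ℝ` are instances.
-/

noncomputable section

open MvPolynomial Finset
open Literature.Probability.LatticeModels

namespace Literature.MathematicalPhysics.StatisticalMechanics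

namespace ComplexSpin

variable {ν : ℕ}

/-! ### Theorem 3.18 (2): thermodynamic limits along subsequences -/

/-- **Theorem 3.18 (2) (existence of thermodynamic limits along subsequences).**  For a complex
spin system with `B = exp(NW)` to order `N`, `w₁ = 1`, `w_k ≥ 0`, `m ≥ 0`, `ν ≥ 1`, and ANY sequence
of even tori `Λ_n = (ℤ/L_n)^ν` (`L_n ≥ 2`), there are a subsequence `n_j` and numbers
`⟨σ^L⟩ ∈ [0, 1]`, one for every multi-index `L` of finite support in `ℤ^ν`, such that
`⟨σ^L⟩_{Λ_{n_j}} → ⟨σ^L⟩` for EVERY `L` simultaneously (the monomial `σ^L` being read on `Λ_n`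
through the projection `ℤ^ν → (ℤ/L_n)^ν`).  Printed proof: `|f_Λ(a)| ≤ ‖a‖₁` by part (1), so the
`f_Λ` lie in the unit ball of `(L¹)^*`, and "by the Banach–Alaoglu theorem the sequence has
accumulation points; … there are subsequences so that `f_{Λ_k}(a)` converges for all `a`"; here:
part (1) puts `(⟨σ^L⟩_{Λ_n})_L` in the compact metrisable cube `[0,1]^{ℒ}` (`ℒ` countable), which is
sequentially compact (Tychonoff + first countability — the separable Banach–Alaoglu).
[cite: SalmhoferSeiler1991, Thm. 3.18 (2) (3.60), proof (3.66)–(3.68)] -/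
theorem exists_subseq_tendsto_expect (hν : 1 ≤ ν) {N : ℕ} (hN : 1 ≤ N) {a w : ℕ → ℝ}
    (hlog : HasLog N a w) (ha0 : a 0 = 1) (hw1 : w 1 = 1) (hw : ∀ k, 2 ≤ k → k ≤ N → 0 ≤ w k)
    {m : ℝ} (hm : 0 ≤ m) (Ls : ℕ → ℕ) [∀ n, NeZero (Ls n)] (hev : ∀ n, Even (Ls n))
    (h2 : ∀ n, 2 ≤ Ls n) :
    ∃ φ : ℕ → ℕ, StrictMono φ ∧ ∃ c : (Site ν →₀ ℕ) → ℝ, ∀ d : Site ν →₀ ℕ,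
      c d ∈ Set.Icc (0 : ℝ) 1 ∧
        Filter.Tendsto (fun n => expect N m a
          (monomial (Finsupp.mapDomain (Torus.proj (Ls (φ n))) d) (1 : ℝ) :
            MvPolynomial (TorusSite ν (Ls (φ n))) ℝ)) Filter.atTop (nhds (c d)) := by
  classical
  -- the sequence of "states" in the cube `[0,1]^{ℒ}`
  set u : ℕ → ((Site ν →₀ ℕ) → ℝ) := fun n d => expect N m a
    (monomial (Finsupp.mapDomain (Torus.proj (Ls n)) d) (1 : ℝ) :
      MvPolynomial (TorusSite ν (Ls n)) ℝ) with hu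
  set K : Set ((Site ν →₀ ℕ) → ℝ) := Set.pi Set.univ fun _ => Set.Icc (0 : ℝ) 1 with hK
  have hKc : IsCompact K := isCompact_univ_pi fun _ => isCompact_Icc
  have huK : ∀ n, u n ∈ K := fun n => by
    simp only [hK, Set.mem_pi, Set.mem_univ, forall_true_left]
    intro d
    exact expect_monomial_mem_Icc hν (hev n) (h2 n) hN hlog ha0 hw1 hw hm _
  obtain ⟨c, hcK, φ, hφ, hlim⟩ := hKc.isSeqCompact huK
  refine ⟨φ, hφ, c, fun d => ⟨?_, ?_⟩⟩
  · simpa [hK] using hcK d (Set.mem_univ d)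
  · have h := tendsto_pi_nhds.1 hlim d
    exact h

/-- **Theorem 3.18 (2) for the `U(N)` model, `1 ≤ N ≤ 4`**: thermodynamic limits of all
correlations along a subsequence of any sequence of even tori. [cite: SalmhoferSeiler1991, Thm. 3.18 (2) with Remark 4.6] -/
theorem uN_exists_subseq_tendsto_expect (hν : 1 ≤ ν) {N : ℕ} (hN1 : 1 ≤ N) (hN4 : N ≤ 4)
    {m : ℝ} (hm : 0 ≤ m) (Ls : ℕ → ℕ) [∀ n, NeZero (Ls n)] (hev : ∀ n, Even (Ls n))
    (h2 : ∀ n, 2 ≤ Ls n) :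
    ∃ φ : ℕ → ℕ, StrictMono φ ∧ ∃ c : (Site ν →₀ ℕ) → ℝ, ∀ d : Site ν →₀ ℕ,
      c d ∈ Set.Icc (0 : ℝ) 1 ∧
        Filter.Tendsto (fun n => expect N m (uNBondCoeff N)
          (monomial (Finsupp.mapDomain (Torus.proj (Ls (φ n))) d) (1 : ℝ) :
            MvPolynomial (TorusSite ν (Ls (φ n))) ℝ)) Filter.atTop (nhds (c d)) :=
  exists_subseq_tendsto_expect hν hN1 (hasLog_uN hN1 hN4) (uNBondCoeff_zero N) (uNLogCoeff_one N)
    (fun k hk2 hkN => uNLogCoeff_nonneg hN4 k hk2 hkN) hm Ls hev h2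

end ComplexSpin

end Literature.MathematicalPhysics.StatisticalMechanics

end
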